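import Summits.BirchSwinnertonDyer.BirchSwinnertonDyer.Theorems.KolyvaginRoadThreeConductorOneData
import HarnessLib

/-!
# Route `KolyvaginRoadThree`, crux `ZhangSharpFrameAtThree` (item stmt-BirchSwinnertonDyer-19153): the A1
# kernel with the crux's hypothesis in the HOFFSTEIN–LUO-SHARP shape (the judge's «optional sharper frame»;
# cell `bsd-stepL`, seat `bsd-stepL-zhang3-p1`; `--supports 19153`, helper; sibling of
# `KolyvaginRoadThreeKernelX11b.lean`, p422717)

THEOREMS ONLY (no definition, no named fact, no `sorry`); nothing about Kolyvagin's conjecture at `p = 3` is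
asserted; CONDITIONAL on every binder; nothing is booked (PARTITION: O2@3 × A1 (1 116 TRUE-OPEN classes; cw
248 943) — types-the-object-of; closes: none). NO Theses import (the route file may import this module).

The judge's package (a) notes an OPTIONAL further restriction of item 19153 (planner g23,
`plan/KOLY-19153-package/PACKAGE.md`): ask Kolyvagin's conjecture mod 3 only «for the HL datum of the kernel»
(`exists_oddHeegnerData`: the Hoffstein–Luo field — imaginary quadratic, `d_K` ODD, Heegner for `N`,
`L(E^{d_K}, 1) ≠ 0` — with a Manin-good frame and `w_K = 2`), thought «typable only by exposing that datum as a
def». No definition is needed: the datum's two PROPERTIES that the ∀-frame typing lacks are first-order binders on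
`K` — `Odd (NumberField.discr K)` and `(W.quadraticTwist (NumberField.discr K : ℚ)).entireLFunction 1 ≠ 0` —
and the kernel has both in hand where it applies `hZ` (`hodd`, `hLt` of `exists_oddHeegnerData`). With them the
crux reads: Kolyvagin's conjecture mod 3 at every Manin-good conductor-1 frame of every pair `(E, K)` with
`(E,3) ∈ X11b`, a (ram) prime, `3 ∤ ∏c`, `K` Heegner with `d_K` odd and `L(E^{d_K},1) ≠ 0` — i.e. with
`r_an(E/K) = 1` EXACTLY (`L(E/K,s) = L(E,s)·L(E^{d_K},s)`), the analytic-rank-one case of W. Zhang 2014 Thm. 1.1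
in which (Remark 5 ∕ Thm. 10.2) `M_∞ = 0` is EQUIVALENT to the `3`-part of the BSD formula for `E/K`: no
surplus in analytic rank `≥ 2` over `ℚ` (the `ClassX11b` binder) NOR over `K` (the `L(E^{d_K},1) ≠ 0` binder —
the `ClassX11b`-only restate still quantifies over Heegner fields with `r_an(E^{d_K}) ≥ 2`, where `y_K` is torsion
and the content is a derived class in analytic rank `≥ 3` over `K`).

* `Koly.bsdp_three_onA1_of_kolyvaginFramesHL` — the A1 kernel with `hZ` in the HL-SHARP shape (binders
  `ClassX11b W 3`, `Odd (NumberField.discr K)`, `(W.quadraticTwist (NumberField.discr K : ℚ)).entireLFunction 1 ≠ 0`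
  added; proof = the kernel verbatim, `hZ` applied with `hX`, `hodd`, `hLt`);
* `Koly.kolyvaginFramesHL_of_kolyvaginFramesX11b` — the X11b shape implies the HL shape (each restate is WEAKER
  than the previous: filed ⇒ X11b ⇒ HL);
* `Theorems.bsdp_three_onA1_of_kolyvaginFramesHL_of_darmon36` — seam G-a discharged by Darmon Thm. 3.6.
The re-certified `closes` for an HL restate is again the rev-3 body with the kernel name changed (farm-checked in
the seat's `ClosesRestated19153.lean`, HOME `zhang3/`). CONDITIONAL on every binder; nothing booked.

References (locators only): [cite: WZhang2014, Thm. 1.1, Remark 5 and Thm. 10.2 (analytic rank one)]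
[cite: McCallumLMS1991, §5 Cor. 5.6 (p. 310)] [cite: GrossLMS1991, §4 (4.1) and Thm. 1.3]
[cite: Darmon2004, Thm. 3.6 (PDF pp. 43–44)] [cite: HoffsteinLuo1997, main theorem (twists with L(1) ≠ 0)].
-/

noncomputable section

open scoped Classical

namespace Summit.BirchSwinnertonDyer.Rank1Residual.X11b.Three.Koly

open WeierstrassCurve Literature.NumberTheory.EllipticCurves
  Literature.NumberTheory.EllipticCurves.ModularForms
  Literature.NumberTheory.EllipticCurves.Rank1Residual
  Summit.BirchSwinnertonDyer.Rank1Residual Summit.BirchSwinnertonDyer.Rank1Residual.X11b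

/-- **The A1 kernel of route `KolyvaginRoadThree` with Kolyvagin's conjecture mod 3 asked ONLY AT HOFFSTEIN–LUO
PAIRS**: `hZ` carries, besides `ClassX11b W 3`, the binders `Odd (NumberField.discr K)` and
`(W.quadraticTwist (NumberField.discr K : ℚ)).entireLFunction 1 ≠ 0` (so `r_an(E/K) = 1` exactly — the
analytic-rank-one case of W. Zhang 2014, Thm. 1.1, where by Remark 5 ∕ Thm. 10.2 `M_∞ = 0` is equivalent to the
`p`-part of BSD for `E/K`). Under the published named facts, the seam `hKD` and this `hZ`: `BSDp W 3` for every
`E` on atom A1. Proof: koly's `bsdp_three_onA1_of_kolyvaginFrames` (p410690) VERBATIM; the kernel's odd Heegner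
datum (`exists_oddHeegnerData`: Hoffstein–Luo field, Mazur, `w_K = 2`) supplies `hodd` and `hLt` where `hZ` is
applied. CONDITIONAL on every binder; nothing booked. [cite: WZhang2014, Thm. 1.1, Remark 5 and Thm. 10.2 (analytic rank one)]
[cite: McCallumLMS1991, §5 Cor. 5.6 (p. 310)] [cite: HoffsteinLuo1997, Thm. (twists with L(1) ≠ 0)] -/
theorem bsdp_three_onA1_of_kolyvaginFramesHL
    -- published named facts
    (hGZ : ∀ (N : ℕ) [NeZero N] (W : WeierstrassCurve ℚ) (K : Type) [Field K] [NumberField K],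
      gross_zagier N W K)
    (hKo : ∀ (N : ℕ) [NeZero N] (W : WeierstrassCurve ℚ) (K : Type) [Field K] [NumberField K],
      kolyvagin N W K)
    (hB : ∀ (N : ℕ) [NeZero N] (W : WeierstrassCurve ℚ) (K : Type) [Field K] [NumberField K],
      Kolyvagin1990_padicValNat_card_sha_le N W K)
    (hSk : Skinner2016.thmC_padicValRat_bsd_rank_zero)
    (hGZK : rank_eq_analyticRank_of_analyticRank_le_one) (hmod : hasEntireLFunction_rat)
    (hnf : exists_isNewformOf) (hHL : HoffsteinLuo1997_exists_twist_L_one_ne_zero)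
    (hMaz : mazur_not_dvd_maninConstant_of_odd)
    (hrec : ∀ (N : ℕ) [NeZero N] (W : WeierstrassCurve ℚ) (K : Type) [Field K] [NumberField K],
      heegnerPointOfConductor_one_galoisConj N W K)
    (hMc : McCallum1991_pow_dvd_card_sha_primary_of_certificate)
    -- SEAM G-a: conductor-1 Kolyvagin–Heegner data exist on every admissible frame (CM theory; hypothesis shape)
    (hKD : ∀ (W : WeierstrassCurve ℚ) [W.IsElliptic] [W.IsGloballyMinimal] [NeZero (W.conductorNorm ℤ)]
      (K : Type) [Field K] [NumberField K]
      (Dt : ModularParametrizationData W (W.conductorNorm ℤ)) (β : ℤ) (ι : K →+* ℂ),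
      IsImaginaryQuadratic K → SatisfiesHeegnerHypothesis (W.conductorNorm ℤ) K →
      (4 * (W.conductorNorm ℤ : ℤ)) ∣ β ^ 2 - NumberField.discr K →
      Nonempty (KolyvaginHeegnerData Dt β ι 1))
    -- SEAM G-b HL-SHARP: Kolyvagin's conjecture mod 3 at every Manin-good frame of a Hoffstein–Luo pair (E, K)
    (hZ : ∀ (W : WeierstrassCurve ℚ) [W.IsElliptic] [W.IsGloballyMinimal] [NeZero (W.conductorNorm ℤ)]
      (K : Type) [Field K] [NumberField K]
      (Dt : ModularParametrizationData W (W.conductorNorm ℤ)) (β : ℤ) (ι : K →+* ℂ),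
      ClassX11b W 3 → W.HasMultiplicativeReductionAtPrime 3 → Rank1Residual.Surj W 3 →
      Rank1Residual.Ram W 3 → ¬ 3 ∣ W.tamagawaProduct →
      IsImaginaryQuadratic K → Odd (NumberField.discr K) →
      SatisfiesHeegnerHypothesis (W.conductorNorm ℤ) K →
      (W.quadraticTwist (NumberField.discr K : ℚ)).entireLFunction 1 ≠ 0 →
      NumberField.discr K ≠ -3 →
      (4 * (W.conductorNorm ℤ : ℤ)) ∣ β ^ 2 - NumberField.discr K → ¬ (3 : ℤ) ∣ Dt.c →
      ∃ (n : ℕ) (d : KolyvaginHeegnerData Dt β ι n),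
        KolyvaginDescent.KolSupp (Zhang2014.IsKolyvaginPrime (W.conductorNorm ℤ) W K 3) n ∧
          d.kolyvaginClass Nat.prime_three 1 ≠ 0)
    -- the pair
    (W : WeierstrassCurve ℚ) [W.IsElliptic] [W.IsGloballyMinimal]
    (hX : ClassX11b W 3) (hram : Ram W 3) (htam : ¬ 3 ∣ W.tamagawaProduct) : BSDp W 3 := by
  haveI : NeZero (W.conductorNorm ℤ) := ⟨(W.conductorNorm_pos_holds).ne'⟩
  have hmult : W.HasMultiplicativeReductionAtPrime 3 := hX.2.2.1
  have hirr : Irr W 3 := hX.2.2.2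
  have hρ : Surj W 3 := surj_of_irr_of_ram W 3 hirr hram
  -- ONE odd Heegner datum with a Manin-good frame (Hoffstein–Luo field; Mazur; w_K = 2)
  obtain ⟨K, _, _, Dt, H, ι, P, Wd, _, _, Cd, hK, hodd, h3d, hHN, hP, hc, hμ, hLt, hWd⟩ :=
    exists_oddHeegnerData hnf hHL hMaz integral_neronScaling_of_isGloballyMinimal_holds W 3 hX.1
      (by decide) hmult hirr
  have h3 : NumberField.discr K ≠ -3 := by
    intro h
    exact h3d (h ▸ ⟨-1, by norm_num⟩)
  -- seam G-a: a conductor-1 Kolyvagin–Heegner datum on the frame (Dt, H.β, ι)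
  obtain ⟨d₁⟩ := hKD W K Dt H.β ι hK hHN H.dvd_sq_sub
  -- the bottom point: P(1) = y_K = P in E(K̄) (Shimura reciprocity at conductor 1, named fact `hrec`)
  have hPd : d₁.toGeomPoints d₁.derivedPoint = toGeomPoints (W.baseChange K) P :=
    KolyvaginBottom.toGeomPoints_derivedPoint_one_eq (hrec _ W K) hK hHN hP d₁ rfl
  -- y_K is non-torsion (Gross–Zagier at r_an = 1 with L(E^{d_K},1) ≠ 0); rank one, Ш finite (Kolyvagin)
  have hPinf : ¬ IsOfFinAddOrder P :=
    not_isOfFinAddOrder_of_heegner_of_analyticRank_eq_one W (W.conductorNorm ℤ) K Dt H ι P (hGZ _ W K) hmod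
      hX.1 hK hHN hLt hP
  obtain ⟨hrank, hSha⟩ := hKo (W.conductorNorm ℤ) W K hK hHN ⟨Dt, H, ι, hP⟩ hPinf
  haveI : Finite (W.baseChange K).sha := hSha
  -- E(K)[3] = 0 (E[3] irreducible, K imaginary quadratic)
  have hbot := torsionBy_eq_bot_of_isImaginaryQuadratic_of_hasIrreducibleModPGaloisRep W K hK
    Nat.prime_three hirr
  have hiv : ∀ x : (W.baseChange K).toAffine.Point, 3 • x = 0 → x = 0 := fun x hx ↦ by
    have hmem : x ∈ AddSubgroup.torsionBy (W.baseChange K).toAffine.Point ((3 : ℕ) : ℤ) := by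
      rw [mem_torsionBy_iff, natCast_zsmul]
      exact hx
    rw [hbot] at hmem
    exact hmem
  -- the exponent 3^{M₀} ∥ y_K (Mordell–Weil)
  haveI : Module.Finite ℤ (W.baseChange K).toAffine.Point := (W.baseChange K).module_finite_point_holds
  obtain ⟨M₀, x₀, hx₀, hmax⟩ := exists_pow_smul_eq_and_forall_ne hPinf (p := 3) (by norm_num)
  have hdiv : ∃ Q : (W.baseChange K).toAffine.Point, ((3 ^ M₀ : ℕ) : ℤ) • Q = P :=
    ⟨x₀, by rw [natCast_zsmul]; exact hx₀⟩
  have hndiv : ¬ ∃ Q : (W.baseChange K).toAffine.Point, ((3 ^ (M₀ + 1) : ℕ) : ℤ) • Q = P := by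
    rintro ⟨Q, hQ⟩
    exact hmax Q (by rw [← natCast_zsmul]; exact hQ)
  -- seam G-b HL-SHARP: Kolyvagin's conjecture mod 3 at this Manin-good frame of THIS Hoffstein–Luo pair
  obtain ⟨n, d, hn, hne⟩ := hZ W K Dt H.β ι hX hmult hρ hram htam hK hodd hHN hLt h3 H.dvd_sq_sub hc
  -- the end-to-end theorem at this datum
  exact ClassX11b.bsdp_three_of_kolyvaginClass_one_ne_zero_of_mccallum W K Dt H ι P (hGZ _ W K) (hKo _ W K)
    (hB _ W K) hSk hGZK hmod hX hram htam hK hodd hHN hP hc hLt Wd Cd hWd H.β d₁ hPd hPinf hrank hiv hdiv hndiv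
    d hn hne hMc

/-- **The X11b-restricted shape implies the HL-sharp shape** (each restate is WEAKER: filed ⇒ X11b ⇒ HL; pure
logic — ignore the two extra binders). [folklore] -/
theorem kolyvaginFramesHL_of_kolyvaginFramesX11b
    (hZ : ∀ (W : WeierstrassCurve ℚ) [W.IsElliptic] [W.IsGloballyMinimal] [NeZero (W.conductorNorm ℤ)]
      (K : Type) [Field K] [NumberField K]
      (Dt : ModularParametrizationData W (W.conductorNorm ℤ)) (β : ℤ) (ι : K →+* ℂ),
      ClassX11b W 3 → W.HasMultiplicativeReductionAtPrime 3 → Rank1Residual.Surj W 3 →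
      Rank1Residual.Ram W 3 → ¬ 3 ∣ W.tamagawaProduct →
      IsImaginaryQuadratic K → SatisfiesHeegnerHypothesis (W.conductorNorm ℤ) K →
      NumberField.discr K ≠ -3 →
      (4 * (W.conductorNorm ℤ : ℤ)) ∣ β ^ 2 - NumberField.discr K → ¬ (3 : ℤ) ∣ Dt.c →
      ∃ (n : ℕ) (d : KolyvaginHeegnerData Dt β ι n),
        KolyvaginDescent.KolSupp (Zhang2014.IsKolyvaginPrime (W.conductorNorm ℤ) W K 3) n ∧
          d.kolyvaginClass Nat.prime_three 1 ≠ 0) :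
    ∀ (W : WeierstrassCurve ℚ) [W.IsElliptic] [W.IsGloballyMinimal] [NeZero (W.conductorNorm ℤ)]
      (K : Type) [Field K] [NumberField K]
      (Dt : ModularParametrizationData W (W.conductorNorm ℤ)) (β : ℤ) (ι : K →+* ℂ),
      ClassX11b W 3 → W.HasMultiplicativeReductionAtPrime 3 → Rank1Residual.Surj W 3 →
      Rank1Residual.Ram W 3 → ¬ 3 ∣ W.tamagawaProduct →
      IsImaginaryQuadratic K → Odd (NumberField.discr K) →
      SatisfiesHeegnerHypothesis (W.conductorNorm ℤ) K →
      (W.quadraticTwist (NumberField.discr K : ℚ)).entireLFunction 1 ≠ 0 →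
      NumberField.discr K ≠ -3 →
      (4 * (W.conductorNorm ℤ : ℤ)) ∣ β ^ 2 - NumberField.discr K → ¬ (3 : ℤ) ∣ Dt.c →
      ∃ (n : ℕ) (d : KolyvaginHeegnerData Dt β ι n),
        KolyvaginDescent.KolSupp (Zhang2014.IsKolyvaginPrime (W.conductorNorm ℤ) W K 3) n ∧
          d.kolyvaginClass Nat.prime_three 1 ≠ 0 :=
  fun W _ _ _ K _ _ Dt β ι hX hmult hsurj hram htam hK _ hH _ ↦ hZ W K Dt β ι hX hmult hsurj hram htam hK hH

end Summit.BirchSwinnertonDyer.Rank1Residual.X11b.Three.Koly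

namespace Summit.BirchSwinnertonDyer.BirchSwinnertonDyer.Theorems

open WeierstrassCurve Literature.NumberTheory.EllipticCurves
  Literature.NumberTheory.EllipticCurves.ModularForms
  Literature.NumberTheory.EllipticCurves.Rank1Residual
  Summit.BirchSwinnertonDyer.Rank1Residual Summit.BirchSwinnertonDyer.Rank1Residual.X11b

/-- **The HL-sharp A1 kernel with seam G-a DISCHARGED by name**: `Koly.bsdp_three_onA1_of_kolyvaginFramesHL` with
`hKD` supplied by Darmon 2004 Thm. 3.6 at conductor 1 (`phi_heegnerTau_mem_range_map_singularModuliField`, via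
koly's `kolyvaginRoadThree_hKD_of_darmon36`). CONDITIONAL on every binder; nothing booked.
[cite: Darmon2004, Thm. 3.6 (PDF pp. 43–44)] [cite: WZhang2014, Thm. 1.1 and Remark 5 (analytic rank one)] -/
theorem bsdp_three_onA1_of_kolyvaginFramesHL_of_darmon36
    (hGZ : ∀ (N : ℕ) [NeZero N] (W : WeierstrassCurve ℚ) (K : Type) [Field K] [NumberField K],
      gross_zagier N W K)
    (hKo : ∀ (N : ℕ) [NeZero N] (W : WeierstrassCurve ℚ) (K : Type) [Field K] [NumberField K],
      kolyvagin N W K)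
    (hB : ∀ (N : ℕ) [NeZero N] (W : WeierstrassCurve ℚ) (K : Type) [Field K] [NumberField K],
      Kolyvagin1990_padicValNat_card_sha_le N W K)
    (hSk : Skinner2016.thmC_padicValRat_bsd_rank_zero)
    (hGZK : rank_eq_analyticRank_of_analyticRank_le_one) (hmod : hasEntireLFunction_rat)
    (hnf : exists_isNewformOf) (hHL : HoffsteinLuo1997_exists_twist_L_one_ne_zero)
    (hMaz : mazur_not_dvd_maninConstant_of_odd)
    (hrec : ∀ (N : ℕ) [NeZero N] (W : WeierstrassCurve ℚ) (K : Type) [Field K] [NumberField K],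
      heegnerPointOfConductor_one_galoisConj N W K)
    (hMc : McCallum1991_pow_dvd_card_sha_primary_of_certificate)
    (h36 : ∀ (N : ℕ) [NeZero N] (W : WeierstrassCurve ℚ) (K : Type) [Field K] [NumberField K],
      phi_heegnerTau_mem_range_map_singularModuliField N W K)
    (hZ : ∀ (W : WeierstrassCurve ℚ) [W.IsElliptic] [W.IsGloballyMinimal] [NeZero (W.conductorNorm ℤ)]
      (K : Type) [Field K] [NumberField K]
      (Dt : ModularParametrizationData W (W.conductorNorm ℤ)) (β : ℤ) (ι : K →+* ℂ),
      ClassX11b W 3 → W.HasMultiplicativeReductionAtPrime 3 → Rank1Residual.Surj W 3 →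
      Rank1Residual.Ram W 3 → ¬ 3 ∣ W.tamagawaProduct →
      IsImaginaryQuadratic K → Odd (NumberField.discr K) →
      SatisfiesHeegnerHypothesis (W.conductorNorm ℤ) K →
      (W.quadraticTwist (NumberField.discr K : ℚ)).entireLFunction 1 ≠ 0 →
      NumberField.discr K ≠ -3 →
      (4 * (W.conductorNorm ℤ : ℤ)) ∣ β ^ 2 - NumberField.discr K → ¬ (3 : ℤ) ∣ Dt.c →
      ∃ (n : ℕ) (d : KolyvaginHeegnerData Dt β ι n),
        KolyvaginDescent.KolSupp (Zhang2014.IsKolyvaginPrime (W.conductorNorm ℤ) W K 3) n ∧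
          d.kolyvaginClass Nat.prime_three 1 ≠ 0)
    (W : WeierstrassCurve ℚ) [W.IsElliptic] [W.IsGloballyMinimal]
    (hX : ClassX11b W 3) (hram : Ram W 3) (htam : ¬ 3 ∣ W.tamagawaProduct) : BSDp W 3 :=
  Summit.BirchSwinnertonDyer.Rank1Residual.X11b.Three.Koly.bsdp_three_onA1_of_kolyvaginFramesHL hGZ hKo hB
    hSk hGZK hmod hnf hHL hMaz hrec hMc (kolyvaginRoadThree_hKD_of_darmon36 h36) hZ W hX hram htam

end Summit.BirchSwinnertonDyer.BirchSwinnertonDyer.Theorems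

end
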